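import Summits.AtomisticToContinuum.BoseEinsteinCondensation.Theses.BECBoundaryReservoir

/-!
# Crux `ShellPenetration` (stmt-AtomisticToContinuum-8767) — birth skeleton (BC3), line `birth-reservoir-window`

Route: `route-AtomisticToContinuum-BECBoundaryReservoir` (rank-2 crux, card K1 PENETRATION; skeleton
registrar planner-skel-stmt-AtomisticToContinuum-8767-0, 2026-08-17). The crux, FIXED and concluded BY NAME
below (`Theses.BECBoundaryReservoir.ShellPenetration`): for every repulsive finite-range `v` there is `ρ₀ > 0`
such that for `0 < ρ < ρ₀` there are a shell width `w`, a pinning strength `κ` and `c > 0` with: for all large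
`N = n + 1` (`L = (N/ρ)^{1/3}`, `g` = normalised indicator of the boundary shell `S_w` of `Λ_L = (0, L)³`) and
some slack `δ > 0`, every `δ`-near-minimiser `Ψ` of the shell-pinned energy `⟨Ψ, H_N Ψ⟩ + κ (N − ⟨g, γ_Ψ g⟩)`
has `⟨g, γ_Ψ g⟩ > 0` and `c · ⟨g, γ_Ψ g⟩ ≤ |⟨1_{B(z,1)}, γ_Ψ g⟩|²` for every unit ball with centre
`z ∈ [2w+1, L−2w−1]³`.

## The cut (three registered stubs; the route header's foreseen split ReservoirFilled → InterfaceLocking →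
BulkStiffness, re-typed so that it survives the refuters' ideal-gas analysis of the crux)

The refuter stamps on the crux (g44-2, g45-36, rattack-8767-0, 2026-08-15) show that `IsRepulsiveFiniteRange`
admits `v ≡ 0`, where for fixed `(w, κ)` exactly three regimes exist: `κ < κ_c = 3/w²` (Dirichlet-sine mode,
shell occupation `O(1)`, penetration FAILS at face-adjacent balls), `κ > κ_c` (shell-bound mode, occupation
`≈ pN`, penetration FAILS at the centre), `κ = κ_c` (zero-energy resonance, occupation `≍ ρ w L² ≍ ρ |S_w|`,
penetration HOLDS). The one observable that separates the good regime from both bad ones is the SHELL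
DENSITY WINDOW `θ |S_w| ≤ ⟨g, γ_Ψ g⟩ ≤ Θ |S_w|` (`|S_w| = L³ − (L − 2w)³`): "the reservoir is filled, at a
bounded density". It is also the route's intended regime for interacting `v` (dilute shell,
`ρ_sh ≈ (κ + 8πaρ)/8πa`). So the window is the hinge of the cut:

* `stub_shellWindow` (RESERVOIR FILLED, variational; size M–L): for small `ρ` there are `(w, κ, θ, Θ)` such
  that eventually every near-minimiser of the pinned energy has shell occupation in the window. Lower bound:
  trial state + concavity of `κ ↦ inf E^κ` (Feynman–Hellmann); upper bound: the repulsion prices an over-dense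
  shell (for `v ≡ 0`: only the resonant `κ = 3/w²`, which the `∃ κ` allows). Why it might fail: at `v ≡ 0`
  it needs the resonance analysis (`‖G_{E₀} 1_S‖² ≍ L³w⁴`) to be right — the same hair the crux hangs on.
* `stub_bulkLocking` (INTERFACE LOCKING + INFRARED STIFFNESS at `k = 0`; the HARDEST stub, open-problem
  size): for small `ρ` and EVERY `(w, κ, θ, Θ)`, if eventually the near-minimisers sit in the window then
  the bulk AS A WHOLE is coherent with the reservoir mode: `c₁ L⁶ ⟨g, γ_Ψ g⟩ ≤ |⟨1_{[2w, L−2w]³}, γ_Ψ g⟩|²`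
  (for a condensate `γ ≈ N_c |φ⟩⟨φ|` with flat `φ` the right side is `≈ ρ_c |bulk|² · ⟨g, γ g⟩_coh`; by
  Cauchy–Schwarz it is `≤ ρ L⁶ ⟨g, γ g⟩`, so `c₁ ≤ ρ`). This is ODLRO between the wall reservoir and the
  zero mode of the bulk — the declared open content of the crux, now isolated from the local question.
  Why it might fail: the d = 3 infrared problem (no tool beyond c-number substitution / GP + spin waves
  controls the phase of the bulk relative to Dirichlet-side data); a dense shell (`Θ` large) may decouple.
* `stub_localEquipartition` (HEALING-LENGTH FLATNESS; size L): for small `ρ` and every `(w, κ, θ, Θ, c₁)`,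
  window ∧ macroscopic locking for the near-minimisers ⟹ EVERY admissible unit ball carries its share of the
  coherence: `c ⟨g, γ_Ψ g⟩ ≤ |⟨1_{B(z,1)}, γ_Ψ g⟩|²`, `z ∈ [2w+1, L−2w−1]³` (no local depletion pocket /
  vortex core of the coherent component in a near-minimiser; the Dirichlet healing layer of width
  `ξ = (8πaρ)^{-1/2}` only costs a factor `(w/ξ)² ∧ 1` in `c`, fixed as `L → ∞`). Why it might fail: the slack
  `δ` is global, so a near-minimiser may afford one depleted ball (cost `O(1)`) unless `δ` is taken below it —
  allowed (`∃ δ` after `n`), but then the stub is a statement about the true ground state's local structure.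

Composition `shellPenetration_of_stubs` (kernel-checked, no `sorry` of its own; hypotheses = the three stub
statements, conclusion = the crux statement verbatim): `ρ₀ := min ρ₀ᴬ (min ρ₀ᴮ¹ ρ₀ᴮ²)`;
`(w, κ, θ, Θ)` and the eventual window from the first stub; `c₁` and eventual locking from the second (fed the
window); the third (fed window ∧ locking on the intersection of the two eventual sets, slack `min δ δ'`) gives
`c` and eventual penetration; finally `0 < θ (L³ − (L−2w)³)` (cube strictly monotone, `w > 0`) turns the
window's lower bound into `0 < ⟨g, γ_Ψ g⟩`, again at slack `min`. `ShellPenetration_of : Theses.….ShellPenetration`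
feeds it the three stubs and is the ONLY theorem of the file concluding the crux by name (A12 by-name policy).

Disproof used: none exists for this crux (`ledger crux ls stmt-AtomisticToContinuum-8767`: no workfiles,
2026-08-17). Refuter evidence honoured: `ShellPenetration_idealgas.md` / crux-attack-8767 (ideal gas survives
only at `κ = 3/w²`) — every stub keeps `∃ κ` where it chooses and carries the WINDOW where it assumes, so no
stub is an instance of the off-resonant ideal-gas failure (checked regime by regime above). Negatives index
(20 items; BEC: SwapJensen stmt-3980, BerryStiffPhaseLRO stmt-14490): disjoint vocabulary, nothing restated.
-/

noncomputable section

open MeasureTheory Filter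
open scoped ENNReal NNReal ComplexConjugate

namespace Summit.AtomisticToContinuum.BoseEinsteinCondensation.Cruxes.ShellPenetration.BirthReservoirWindow

open Literature.MathematicalPhysics.QuantumManyBody.BoseGas

/-! ## Registered stubs

Everything is INLINED over existing declarations (`BoseGas.{IsRepulsiveFiniteRange, sideLength, TrialState,
energy, occupation}`, Mathlib). Informal notation for the docstrings: `N = n + 1`, `L = sideLength ρ N`,
`S_w = {x ∈ Λ_L | ∃ k, x_k ≤ w ∨ L − w ≤ x_k}`, `|S_w| = L³ − (L − 2w)³`, `g = |S_w|^{-1/2} 1_{S_w}`,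
pinned energy `E^κ(Ψ) = energy v Ψ + κ (N − ⟨g, γ_Ψ g⟩)`, `δ`-near-minimiser: `E^κ(Ψ) ≤ inf E^κ + δ`,
`⟨g, γ_Ψ g⟩ = occupation N g Ψ.ψ`, and for a set `A ⊆ ℝ³`
`|⟨1_A, γ_Ψ g⟩|² = ‖N ∫ dY (∫_A Ψ(x, Y) dx) · conj (∫ conj(g x) Ψ(x, Y) dx)‖²` — with `A = B(z, 1)` this is
LITERALLY the right-hand side of the crux. -/

/-- **Stub 1 — the pinning fills the shell at a bounded density (RESERVOIR WINDOW).** For every repulsive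
finite-range `v` there is `ρ₀ > 0` such that for `0 < ρ < ρ₀` there are a width `w > 0`, a strength `κ > 0`
and densities `0 < θ`, `Θ` with: for all large `N` and some slack `δ > 0`, every `δ`-near-minimiser `Ψ` of
the shell-pinned energy has `θ |S_w| ≤ ⟨g, γ_Ψ g⟩ ≤ Θ |S_w|`. Variational (trial state + concavity in `κ`
for the floor, repulsion for the ceiling); at `v ≡ 0` true exactly at the resonant `κ = 3/w²`
(occupation `≍ ρ w L²`), which the `∃ κ` selects. Size M–L. -/
theorem stub_shellWindow :
    ∀ v : ℝ → ℝ≥0∞, IsRepulsiveFiniteRange v → ∃ ρ₀ : ℝ, 0 < ρ₀ ∧ ∀ ρ : ℝ, 0 < ρ → ρ < ρ₀ →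
      ∃ w κ θ Θ : ℝ, 0 < w ∧ 0 < κ ∧ 0 < θ ∧ ∀ᶠ n : ℕ in atTop, ∃ δ : ℝ≥0∞, 0 < δ ∧
      let L : ℝ := sideLength ρ (n + 1)
      let g : EuclideanSpace ℝ (Fin 3) → ℂ := Set.indicator
        {x | (∀ k, x k ∈ Set.Ioo 0 L) ∧ ∃ k, x k ≤ w ∨ L - w ≤ x k}
        (fun _ => ((Real.sqrt (L ^ 3 - (L - 2 * w) ^ 3))⁻¹ : ℂ))
      ∀ Ψ : TrialState (n + 1) L,
        energy v Ψ + ENNReal.ofReal κ * ((n + 1 : ℝ≥0∞) - occupation (n + 1) g Ψ.ψ) ≤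
          (⨅ Φ : TrialState (n + 1) L,
            energy v Φ + ENNReal.ofReal κ * ((n + 1 : ℝ≥0∞) - occupation (n + 1) g Φ.ψ)) + δ →
        ENNReal.ofReal (θ * (L ^ 3 - (L - 2 * w) ^ 3)) ≤ occupation (n + 1) g Ψ.ψ ∧
          occupation (n + 1) g Ψ.ψ ≤ ENNReal.ofReal (Θ * (L ^ 3 - (L - 2 * w) ^ 3)) := by
  sorry

/-- **Stub 2 — a filled reservoir locks the bulk zero mode (BULK LOCKING; the hardest stub).** For every
repulsive finite-range `v` there is `ρ₀ > 0` such that for `0 < ρ < ρ₀` and EVERY `w, κ, θ > 0`, `Θ`: if for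
all large `N` and some slack the near-minimisers of the shell-pinned energy have shell occupation in the
window `[θ |S_w|, Θ |S_w|]`, then there is `c₁ > 0` such that for all large `N` and some slack every
near-minimiser satisfies `c₁ L⁶ ⟨g, γ_Ψ g⟩ ≤ |⟨1_{[2w, L−2w]³}, γ_Ψ g⟩|²` — the bulk as a whole is
coherent with the reservoir mode (per reservoir particle, at the condensate scale `ρ_c |bulk|²`). The
infrared / ODLRO content of the crux. Open-problem size. -/
theorem stub_bulkLocking :
    ∀ v : ℝ → ℝ≥0∞, IsRepulsiveFiniteRange v → ∃ ρ₀ : ℝ, 0 < ρ₀ ∧ ∀ ρ : ℝ, 0 < ρ → ρ < ρ₀ →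
      ∀ w κ θ Θ : ℝ, 0 < w → 0 < κ → 0 < θ →
      (∀ᶠ n : ℕ in atTop, ∃ δ : ℝ≥0∞, 0 < δ ∧
        let L : ℝ := sideLength ρ (n + 1)
        let g : EuclideanSpace ℝ (Fin 3) → ℂ := Set.indicator
          {x | (∀ k, x k ∈ Set.Ioo 0 L) ∧ ∃ k, x k ≤ w ∨ L - w ≤ x k}
          (fun _ => ((Real.sqrt (L ^ 3 - (L - 2 * w) ^ 3))⁻¹ : ℂ))
        ∀ Ψ : TrialState (n + 1) L,
          energy v Ψ + ENNReal.ofReal κ * ((n + 1 : ℝ≥0∞) - occupation (n + 1) g Ψ.ψ) ≤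
            (⨅ Φ : TrialState (n + 1) L,
              energy v Φ + ENNReal.ofReal κ * ((n + 1 : ℝ≥0∞) - occupation (n + 1) g Φ.ψ)) + δ →
          ENNReal.ofReal (θ * (L ^ 3 - (L - 2 * w) ^ 3)) ≤ occupation (n + 1) g Ψ.ψ ∧
            occupation (n + 1) g Ψ.ψ ≤ ENNReal.ofReal (Θ * (L ^ 3 - (L - 2 * w) ^ 3))) →
      ∃ c₁ : ℝ, 0 < c₁ ∧ ∀ᶠ n : ℕ in atTop, ∃ δ : ℝ≥0∞, 0 < δ ∧
        let L : ℝ := sideLength ρ (n + 1)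
        let g : EuclideanSpace ℝ (Fin 3) → ℂ := Set.indicator
          {x | (∀ k, x k ∈ Set.Ioo 0 L) ∧ ∃ k, x k ≤ w ∨ L - w ≤ x k}
          (fun _ => ((Real.sqrt (L ^ 3 - (L - 2 * w) ^ 3))⁻¹ : ℂ))
        ∀ Ψ : TrialState (n + 1) L,
          energy v Ψ + ENNReal.ofReal κ * ((n + 1 : ℝ≥0∞) - occupation (n + 1) g Ψ.ψ) ≤
            (⨅ Φ : TrialState (n + 1) L,
              energy v Φ + ENNReal.ofReal κ * ((n + 1 : ℝ≥0∞) - occupation (n + 1) g Φ.ψ)) + δ →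
          c₁ * L ^ 6 * (occupation (n + 1) g Ψ.ψ).toReal ≤
            ‖(n + 1 : ℂ) * ∫ Y : Fin n → EuclideanSpace ℝ (Fin 3),
              (∫ x in {x : EuclideanSpace ℝ (Fin 3) | ∀ k, x k ∈ Set.Icc (2 * w) (L - 2 * w)},
                Ψ.ψ (Matrix.vecCons x Y)) *
              conj (∫ x, conj (g x) * Ψ.ψ (Matrix.vecCons x Y))‖ ^ 2 := by
  sorry

/-- **Stub 3 — macroscopic locking spreads to every unit ball (LOCAL EQUIPARTITION).** For every repulsive
finite-range `v` there is `ρ₀ > 0` such that for `0 < ρ < ρ₀` and every `w, κ, θ > 0`, `Θ`, `c₁ > 0`: if for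
all large `N` and some slack the near-minimisers of the shell-pinned energy have shell occupation in the
window AND bulk locking `c₁ L⁶ ⟨g, γ_Ψ g⟩ ≤ |⟨1_{[2w, L−2w]³}, γ_Ψ g⟩|²`, then there is `c > 0` such that
for all large `N` and some slack every near-minimiser has `c ⟨g, γ_Ψ g⟩ ≤ |⟨1_{B(z,1)}, γ_Ψ g⟩|²` for every
`z ∈ [2w+1, L−2w−1]³` — the coherent component has no depleted unit ball (healing-length flatness of the
near-minimisers; the Dirichlet healing layer costs only a factor fixed as `L → ∞`). Size L. -/
theorem stub_localEquipartition :
    ∀ v : ℝ → ℝ≥0∞, IsRepulsiveFiniteRange v → ∃ ρ₀ : ℝ, 0 < ρ₀ ∧ ∀ ρ : ℝ, 0 < ρ → ρ < ρ₀ →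
      ∀ w κ θ Θ c₁ : ℝ, 0 < w → 0 < κ → 0 < θ → 0 < c₁ →
      (∀ᶠ n : ℕ in atTop, ∃ δ : ℝ≥0∞, 0 < δ ∧
        let L : ℝ := sideLength ρ (n + 1)
        let g : EuclideanSpace ℝ (Fin 3) → ℂ := Set.indicator
          {x | (∀ k, x k ∈ Set.Ioo 0 L) ∧ ∃ k, x k ≤ w ∨ L - w ≤ x k}
          (fun _ => ((Real.sqrt (L ^ 3 - (L - 2 * w) ^ 3))⁻¹ : ℂ))
        ∀ Ψ : TrialState (n + 1) L,
          energy v Ψ + ENNReal.ofReal κ * ((n + 1 : ℝ≥0∞) - occupation (n + 1) g Ψ.ψ) ≤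
            (⨅ Φ : TrialState (n + 1) L,
              energy v Φ + ENNReal.ofReal κ * ((n + 1 : ℝ≥0∞) - occupation (n + 1) g Φ.ψ)) + δ →
          ENNReal.ofReal (θ * (L ^ 3 - (L - 2 * w) ^ 3)) ≤ occupation (n + 1) g Ψ.ψ ∧
            occupation (n + 1) g Ψ.ψ ≤ ENNReal.ofReal (Θ * (L ^ 3 - (L - 2 * w) ^ 3)) ∧
            c₁ * L ^ 6 * (occupation (n + 1) g Ψ.ψ).toReal ≤
              ‖(n + 1 : ℂ) * ∫ Y : Fin n → EuclideanSpace ℝ (Fin 3),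
                (∫ x in {x : EuclideanSpace ℝ (Fin 3) | ∀ k, x k ∈ Set.Icc (2 * w) (L - 2 * w)},
                  Ψ.ψ (Matrix.vecCons x Y)) *
                conj (∫ x, conj (g x) * Ψ.ψ (Matrix.vecCons x Y))‖ ^ 2) →
      ∃ c : ℝ, 0 < c ∧ ∀ᶠ n : ℕ in atTop, ∃ δ : ℝ≥0∞, 0 < δ ∧
        let L : ℝ := sideLength ρ (n + 1)
        let g : EuclideanSpace ℝ (Fin 3) → ℂ := Set.indicator
          {x | (∀ k, x k ∈ Set.Ioo 0 L) ∧ ∃ k, x k ≤ w ∨ L - w ≤ x k}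
          (fun _ => ((Real.sqrt (L ^ 3 - (L - 2 * w) ^ 3))⁻¹ : ℂ))
        ∀ Ψ : TrialState (n + 1) L,
          energy v Ψ + ENNReal.ofReal κ * ((n + 1 : ℝ≥0∞) - occupation (n + 1) g Ψ.ψ) ≤
            (⨅ Φ : TrialState (n + 1) L,
              energy v Φ + ENNReal.ofReal κ * ((n + 1 : ℝ≥0∞) - occupation (n + 1) g Φ.ψ)) + δ →
          ∀ z : EuclideanSpace ℝ (Fin 3), (∀ k, z k ∈ Set.Icc (2 * w + 1) (L - 2 * w - 1)) →
            c * (occupation (n + 1) g Ψ.ψ).toReal ≤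
              ‖(n + 1 : ℂ) * ∫ Y : Fin n → EuclideanSpace ℝ (Fin 3),
                (∫ x in Metric.ball z 1, Ψ.ψ (Matrix.vecCons x Y)) *
                conj (∫ x, conj (g x) * Ψ.ψ (Matrix.vecCons x Y))‖ ^ 2 := by
  sorry

/-! ## The composition (kernel-checked, no `sorry` of its own) -/

/-- **The three stub statements imply the crux statement** (conclusion = the body of
`Theses.BECBoundaryReservoir.ShellPenetration`, spelled out verbatim so that exactly ONE theorem of this file,
`ShellPenetration_of`, concludes the crux by name — the A12 skeleton audit's by-name policy):
`ρ₀ := min` of the three thresholds; `(w, κ, θ, Θ)` and the eventual window from the first hypothesis;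
`c₁` and eventual locking from the second; window ∧ locking on the intersection (slack `min`) feeds the
third, which gives `c` and eventual penetration; positivity of the occupation comes from the window's floor
and `0 < L³ − (L − 2w)³` (cube strictly monotone, `w > 0`). [folklore] -/
theorem shellPenetration_of_stubs
    (hA : ∀ v : ℝ → ℝ≥0∞, IsRepulsiveFiniteRange v → ∃ ρ₀ : ℝ, 0 < ρ₀ ∧ ∀ ρ : ℝ, 0 < ρ → ρ < ρ₀ →
      ∃ w κ θ Θ : ℝ, 0 < w ∧ 0 < κ ∧ 0 < θ ∧ ∀ᶠ n : ℕ in atTop, ∃ δ : ℝ≥0∞, 0 < δ ∧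
      let L : ℝ := sideLength ρ (n + 1)
      let g : EuclideanSpace ℝ (Fin 3) → ℂ := Set.indicator
        {x | (∀ k, x k ∈ Set.Ioo 0 L) ∧ ∃ k, x k ≤ w ∨ L - w ≤ x k}
        (fun _ => ((Real.sqrt (L ^ 3 - (L - 2 * w) ^ 3))⁻¹ : ℂ))
      ∀ Ψ : TrialState (n + 1) L,
        energy v Ψ + ENNReal.ofReal κ * ((n + 1 : ℝ≥0∞) - occupation (n + 1) g Ψ.ψ) ≤
          (⨅ Φ : TrialState (n + 1) L,
            energy v Φ + ENNReal.ofReal κ * ((n + 1 : ℝ≥0∞) - occupation (n + 1) g Φ.ψ)) + δ →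
        ENNReal.ofReal (θ * (L ^ 3 - (L - 2 * w) ^ 3)) ≤ occupation (n + 1) g Ψ.ψ ∧
          occupation (n + 1) g Ψ.ψ ≤ ENNReal.ofReal (Θ * (L ^ 3 - (L - 2 * w) ^ 3)))
    (hB : ∀ v : ℝ → ℝ≥0∞, IsRepulsiveFiniteRange v → ∃ ρ₀ : ℝ, 0 < ρ₀ ∧ ∀ ρ : ℝ, 0 < ρ → ρ < ρ₀ →
      ∀ w κ θ Θ : ℝ, 0 < w → 0 < κ → 0 < θ →
      (∀ᶠ n : ℕ in atTop, ∃ δ : ℝ≥0∞, 0 < δ ∧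
        let L : ℝ := sideLength ρ (n + 1)
        let g : EuclideanSpace ℝ (Fin 3) → ℂ := Set.indicator
          {x | (∀ k, x k ∈ Set.Ioo 0 L) ∧ ∃ k, x k ≤ w ∨ L - w ≤ x k}
          (fun _ => ((Real.sqrt (L ^ 3 - (L - 2 * w) ^ 3))⁻¹ : ℂ))
        ∀ Ψ : TrialState (n + 1) L,
          energy v Ψ + ENNReal.ofReal κ * ((n + 1 : ℝ≥0∞) - occupation (n + 1) g Ψ.ψ) ≤
            (⨅ Φ : TrialState (n + 1) L,
              energy v Φ + ENNReal.ofReal κ * ((n + 1 : ℝ≥0∞) - occupation (n + 1) g Φ.ψ)) + δ →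
          ENNReal.ofReal (θ * (L ^ 3 - (L - 2 * w) ^ 3)) ≤ occupation (n + 1) g Ψ.ψ ∧
            occupation (n + 1) g Ψ.ψ ≤ ENNReal.ofReal (Θ * (L ^ 3 - (L - 2 * w) ^ 3))) →
      ∃ c₁ : ℝ, 0 < c₁ ∧ ∀ᶠ n : ℕ in atTop, ∃ δ : ℝ≥0∞, 0 < δ ∧
        let L : ℝ := sideLength ρ (n + 1)
        let g : EuclideanSpace ℝ (Fin 3) → ℂ := Set.indicator
          {x | (∀ k, x k ∈ Set.Ioo 0 L) ∧ ∃ k, x k ≤ w ∨ L - w ≤ x k}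
          (fun _ => ((Real.sqrt (L ^ 3 - (L - 2 * w) ^ 3))⁻¹ : ℂ))
        ∀ Ψ : TrialState (n + 1) L,
          energy v Ψ + ENNReal.ofReal κ * ((n + 1 : ℝ≥0∞) - occupation (n + 1) g Ψ.ψ) ≤
            (⨅ Φ : TrialState (n + 1) L,
              energy v Φ + ENNReal.ofReal κ * ((n + 1 : ℝ≥0∞) - occupation (n + 1) g Φ.ψ)) + δ →
          c₁ * L ^ 6 * (occupation (n + 1) g Ψ.ψ).toReal ≤
            ‖(n + 1 : ℂ) * ∫ Y : Fin n → EuclideanSpace ℝ (Fin 3),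
              (∫ x in {x : EuclideanSpace ℝ (Fin 3) | ∀ k, x k ∈ Set.Icc (2 * w) (L - 2 * w)},
                Ψ.ψ (Matrix.vecCons x Y)) *
              conj (∫ x, conj (g x) * Ψ.ψ (Matrix.vecCons x Y))‖ ^ 2)
    (hC : ∀ v : ℝ → ℝ≥0∞, IsRepulsiveFiniteRange v → ∃ ρ₀ : ℝ, 0 < ρ₀ ∧ ∀ ρ : ℝ, 0 < ρ → ρ < ρ₀ →
      ∀ w κ θ Θ c₁ : ℝ, 0 < w → 0 < κ → 0 < θ → 0 < c₁ →
      (∀ᶠ n : ℕ in atTop, ∃ δ : ℝ≥0∞, 0 < δ ∧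
        let L : ℝ := sideLength ρ (n + 1)
        let g : EuclideanSpace ℝ (Fin 3) → ℂ := Set.indicator
          {x | (∀ k, x k ∈ Set.Ioo 0 L) ∧ ∃ k, x k ≤ w ∨ L - w ≤ x k}
          (fun _ => ((Real.sqrt (L ^ 3 - (L - 2 * w) ^ 3))⁻¹ : ℂ))
        ∀ Ψ : TrialState (n + 1) L,
          energy v Ψ + ENNReal.ofReal κ * ((n + 1 : ℝ≥0∞) - occupation (n + 1) g Ψ.ψ) ≤
            (⨅ Φ : TrialState (n + 1) L,
              energy v Φ + ENNReal.ofReal κ * ((n + 1 : ℝ≥0∞) - occupation (n + 1) g Φ.ψ)) + δ →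
          ENNReal.ofReal (θ * (L ^ 3 - (L - 2 * w) ^ 3)) ≤ occupation (n + 1) g Ψ.ψ ∧
            occupation (n + 1) g Ψ.ψ ≤ ENNReal.ofReal (Θ * (L ^ 3 - (L - 2 * w) ^ 3)) ∧
            c₁ * L ^ 6 * (occupation (n + 1) g Ψ.ψ).toReal ≤
              ‖(n + 1 : ℂ) * ∫ Y : Fin n → EuclideanSpace ℝ (Fin 3),
                (∫ x in {x : EuclideanSpace ℝ (Fin 3) | ∀ k, x k ∈ Set.Icc (2 * w) (L - 2 * w)},
                  Ψ.ψ (Matrix.vecCons x Y)) *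
                conj (∫ x, conj (g x) * Ψ.ψ (Matrix.vecCons x Y))‖ ^ 2) →
      ∃ c : ℝ, 0 < c ∧ ∀ᶠ n : ℕ in atTop, ∃ δ : ℝ≥0∞, 0 < δ ∧
        let L : ℝ := sideLength ρ (n + 1)
        let g : EuclideanSpace ℝ (Fin 3) → ℂ := Set.indicator
          {x | (∀ k, x k ∈ Set.Ioo 0 L) ∧ ∃ k, x k ≤ w ∨ L - w ≤ x k}
          (fun _ => ((Real.sqrt (L ^ 3 - (L - 2 * w) ^ 3))⁻¹ : ℂ))
        ∀ Ψ : TrialState (n + 1) L,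
          energy v Ψ + ENNReal.ofReal κ * ((n + 1 : ℝ≥0∞) - occupation (n + 1) g Ψ.ψ) ≤
            (⨅ Φ : TrialState (n + 1) L,
              energy v Φ + ENNReal.ofReal κ * ((n + 1 : ℝ≥0∞) - occupation (n + 1) g Φ.ψ)) + δ →
          ∀ z : EuclideanSpace ℝ (Fin 3), (∀ k, z k ∈ Set.Icc (2 * w + 1) (L - 2 * w - 1)) →
            c * (occupation (n + 1) g Ψ.ψ).toReal ≤
              ‖(n + 1 : ℂ) * ∫ Y : Fin n → EuclideanSpace ℝ (Fin 3),
                (∫ x in Metric.ball z 1, Ψ.ψ (Matrix.vecCons x Y)) *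
                conj (∫ x, conj (g x) * Ψ.ψ (Matrix.vecCons x Y))‖ ^ 2) :
    ∀ v : ℝ → ENNReal, Literature.MathematicalPhysics.QuantumManyBody.BoseGas.IsRepulsiveFiniteRange v →
      ∃ ρ₀ : ℝ, 0 < ρ₀ ∧ ∀ ρ : ℝ, 0 < ρ → ρ < ρ₀ → ∃ w κ c : ℝ, 0 < w ∧ 0 < κ ∧ 0 < c ∧
      ∀ᶠ n : ℕ in Filter.atTop, ∃ δ : ENNReal, 0 < δ ∧
      let L : ℝ := Literature.MathematicalPhysics.QuantumManyBody.BoseGas.sideLength ρ (n + 1);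
      let g : EuclideanSpace ℝ (Fin 3) → ℂ := Set.indicator {x | (∀ k, x k ∈ Set.Ioo 0 L) ∧ ∃ k, x k ≤ w ∨ L - w ≤ x k} (fun _ => ((Real.sqrt (L ^ 3 - (L - 2 * w) ^ 3))⁻¹ : ℂ));
      ∀ Ψ : Literature.MathematicalPhysics.QuantumManyBody.BoseGas.TrialState (n + 1) L,
        Literature.MathematicalPhysics.QuantumManyBody.BoseGas.energy v Ψ + ENNReal.ofReal κ * ((n + 1 : ENNReal) -
            Literature.MathematicalPhysics.QuantumManyBody.BoseGas.occupation (n + 1) g Ψ.ψ) ≤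
          (⨅ Φ : Literature.MathematicalPhysics.QuantumManyBody.BoseGas.TrialState (n + 1) L,
            Literature.MathematicalPhysics.QuantumManyBody.BoseGas.energy v Φ + ENNReal.ofReal κ * ((n + 1 : ENNReal) -
              Literature.MathematicalPhysics.QuantumManyBody.BoseGas.occupation (n + 1) g Φ.ψ)) + δ →
        0 < Literature.MathematicalPhysics.QuantumManyBody.BoseGas.occupation (n + 1) g Ψ.ψ ∧
          ∀ z : EuclideanSpace ℝ (Fin 3), (∀ k, z k ∈ Set.Icc (2 * w + 1) (L - 2 * w - 1)) →
            c * (Literature.MathematicalPhysics.QuantumManyBody.BoseGas.occupation (n + 1) g Ψ.ψ).toReal ≤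
              ‖(n + 1 : ℂ) * ∫ Y : Fin n → EuclideanSpace ℝ (Fin 3), (∫ x in Metric.ball z 1, Ψ.ψ (Matrix.vecCons x Y)) *
                conj (∫ x, conj (g x) * Ψ.ψ (Matrix.vecCons x Y))‖ ^ 2 := by
  intro v hv
  obtain ⟨ρA, hρA, hA⟩ := hA v hv
  obtain ⟨ρB, hρB, hB⟩ := hB v hv
  obtain ⟨ρC, hρC, hC⟩ := hC v hv
  refine ⟨min ρA (min ρB ρC), lt_min hρA (lt_min hρB hρC), fun ρ hρ hρlt => ?_⟩
  have hρltA : ρ < ρA := hρlt.trans_le (min_le_left _ _)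
  have hρltB : ρ < ρB := (hρlt.trans_le (min_le_right _ _)).trans_le (min_le_left _ _)
  have hρltC : ρ < ρC := (hρlt.trans_le (min_le_right _ _)).trans_le (min_le_right _ _)
  -- Stub 1: the window, with its parameters.
  obtain ⟨w, κ, θ, Θ, hw, hκ, hθ, hevA⟩ := hA ρ hρ hρltA
  -- Stub 2: bulk locking, fed the window.
  obtain ⟨c₁, hc₁, hevB⟩ := hB ρ hρ hρltB w κ θ Θ hw hκ hθ hevA
  -- Window ∧ locking on the intersection of the two eventual sets (slack `min`).
  have hevAB : ∀ᶠ n : ℕ in atTop, ∃ δ : ℝ≥0∞, 0 < δ ∧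
      let L : ℝ := sideLength ρ (n + 1)
      let g : EuclideanSpace ℝ (Fin 3) → ℂ := Set.indicator
        {x | (∀ k, x k ∈ Set.Ioo 0 L) ∧ ∃ k, x k ≤ w ∨ L - w ≤ x k}
        (fun _ => ((Real.sqrt (L ^ 3 - (L - 2 * w) ^ 3))⁻¹ : ℂ))
      ∀ Ψ : TrialState (n + 1) L,
        energy v Ψ + ENNReal.ofReal κ * ((n + 1 : ℝ≥0∞) - occupation (n + 1) g Ψ.ψ) ≤
          (⨅ Φ : TrialState (n + 1) L,
            energy v Φ + ENNReal.ofReal κ * ((n + 1 : ℝ≥0∞) - occupation (n + 1) g Φ.ψ)) + δ →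
        ENNReal.ofReal (θ * (L ^ 3 - (L - 2 * w) ^ 3)) ≤ occupation (n + 1) g Ψ.ψ ∧
          occupation (n + 1) g Ψ.ψ ≤ ENNReal.ofReal (Θ * (L ^ 3 - (L - 2 * w) ^ 3)) ∧
          c₁ * L ^ 6 * (occupation (n + 1) g Ψ.ψ).toReal ≤
            ‖(n + 1 : ℂ) * ∫ Y : Fin n → EuclideanSpace ℝ (Fin 3),
              (∫ x in {x : EuclideanSpace ℝ (Fin 3) | ∀ k, x k ∈ Set.Icc (2 * w) (L - 2 * w)},
                Ψ.ψ (Matrix.vecCons x Y)) *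
              conj (∫ x, conj (g x) * Ψ.ψ (Matrix.vecCons x Y))‖ ^ 2 := by
    filter_upwards [hevA, hevB] with n hnA hnB
    obtain ⟨δA, hδA, hnA⟩ := hnA
    obtain ⟨δB, hδB, hnB⟩ := hnB
    refine ⟨min δA δB, lt_min hδA hδB, ?_⟩
    intro L g Ψ hΨ
    have hΨA := hΨ.trans (add_le_add le_rfl (min_le_left δA δB))
    have hΨB := hΨ.trans (add_le_add le_rfl (min_le_right δA δB))
    obtain ⟨hlo, hhi⟩ := hnA Ψ hΨA
    exact ⟨hlo, hhi, hnB Ψ hΨB⟩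
  -- Stub 3: local equipartition, fed window ∧ locking.
  obtain ⟨c, hc, hevC⟩ := hC ρ hρ hρltC w κ θ Θ c₁ hw hκ hθ hc₁ hevAB
  refine ⟨w, κ, c, hw, hκ, hc, ?_⟩
  -- Positivity of the shell volume `L³ − (L − 2w)³` (cube strictly monotone, `w > 0`).
  have hvol : ∀ L : ℝ, 0 < θ * (L ^ 3 - (L - 2 * w) ^ 3) := by
    intro L
    have hlt : (L - 2 * w) ^ 3 < L ^ 3 :=
      Odd.strictMono_pow (by decide : Odd 3) (by linarith : L - 2 * w < L)
    exact mul_pos hθ (sub_pos.mpr hlt)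
  filter_upwards [hevA, hevC] with n hnA hnC
  obtain ⟨δA, hδA, hnA⟩ := hnA
  obtain ⟨δC, hδC, hnC⟩ := hnC
  refine ⟨min δA δC, lt_min hδA hδC, ?_⟩
  intro L g Ψ hΨ
  have hΨA := hΨ.trans (add_le_add le_rfl (min_le_left δA δC))
  have hΨC := hΨ.trans (add_le_add le_rfl (min_le_right δA δC))
  obtain ⟨hlo, -⟩ := hnA Ψ hΨA
  refine ⟨lt_of_lt_of_le (ENNReal.ofReal_pos.mpr (hvol L)) hlo, ?_⟩
  exact hnC Ψ hΨC

/-- **`ShellPenetration` from the three registered stubs** — the crux BY NAME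
(`Summit.AtomisticToContinuum.BoseEinsteinCondensation.Theses.BECBoundaryReservoir.ShellPenetration`), the only
theorem of this file concluding it; kernel-checked composition `shellPenetration_of_stubs` fed with
`stub_shellWindow`, `stub_bulkLocking`, `stub_localEquipartition`, whose `sorry`s are the only ones in the
file — so it closes the crux the day the three stubs are theorems. [folklore] -/
theorem ShellPenetration_of : Theses.BECBoundaryReservoir.ShellPenetration :=
  shellPenetration_of_stubs stub_shellWindow stub_bulkLocking stub_localEquipartition

end Summit.AtomisticToContinuum.BoseEinsteinCondensation.Cruxes.ShellPenetration.BirthReservoirWindow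

end
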